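import Literature.NumberTheory.NumberFields.CyclicCubicField1339B
import Mathlib.NumberTheory.NumberField.ClassNumber
import HarnessLib

/-!
# The cyclic cubic field of conductor `1339` (`2` inert): Dedekind–Kummer, the prime ideals `𝔭_{p,m}`, discriminant `1339²`, Minkowski bound

Second file on `K = K'' = ℚ(θ)`, `θ³ + θ² - 446θ - 3769 = 0` (`CyclicCubicField1339B.lean`: `𝓞 K = ℤ[θ]`,
units, `Gal(K/ℚ) = ⟨σ⟩`, units modulo squares). It prepares the class-group certificate of
`CyclicCubicField1339BClassGroup.lean` (the class group has exponent `3`, hence odd order — all that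
the `2`-descent of `480a1` over `K` needs) and the descent proper. Everything is PROVED:

* **Dedekind–Kummer for `𝓞 K = ℤ[θ]`** (exponent `1`): `exists_factor_of_mem_primesOver`,
  `eq_span_of_no_root` (`2, 3, 5` are inert: `span_inert`), and for a prime `p` at which
  `f ≡ (X - m₁)(X - m₂)(X - m₃)` (Vieta congruences, decidable) every prime above `p` is one of the
  `𝔭_{p,mᵢ}` (`eq_P_of_mem_primesOver`; this also covers the totally ramified `13, 103` with
  `m₁ = m₂ = m₃`);
* **the prime ideals `𝔭_{p,m} = ker(ψ_{p,m} : 𝓞 K → ℤ/p, θ ↦ m)`** for a root `m` of `f mod p`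
  (`P p m hm`): maximal, of norm `p`, with decidable membership `x ∈ 𝔭 ↔ ψ x = 0`; distinctness;
* **certified factorisations** `(x) = 𝔭₁𝔭₂𝔭₃` from memberships and `|N(x)| = p₁p₂p₃`
  (`span_singleton_eq_mul₃`, `…₂`, `…₁`), with the integer norm form `normForm`;
* `d_K = 1792921 = 1339²` (`discr_eq`, from the `ℤ`-basis `1, θ, θ²`) and `⌊M_K⌋ ≤ 297`
  (`floor_minkowskiBound_le`; `r₂ = 0`).

## References

* D. A. Marcus, *Number Fields*, 2nd ed. (2018), Ch. 3, Thm. 27 (Dedekind–Kummer); Ch. 5, Cor. 2 of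
  Thm. 37 (Minkowski bound). [cite: Marcus2018, Ch. 5, Thm. 37]
* T. Dokchitser, V. Dokchitser, J. Number Theory 131 (2011) 1833–1839, proof of Thm. 2.
  [DokchitserDokchitser2011RankModN]
-/

noncomputable section

open Polynomial NumberField Algebra Ideal
open scoped nonZeroDivisors

namespace Literature.NumberTheory.NumberFields

namespace CyclicCubic1339B

/-! ### Dedekind–Kummer for `𝓞 K = ℤ[θ]` -/

/-- The reduction of `f` modulo `p`. [folklore] -/
def cubicPolyMod (p : ℕ) : (ZMod p)[X] := cubicPoly.map (Int.castRingHom (ZMod p))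

/-- `f mod p` is monic. [folklore] -/
theorem monic_cubicPolyMod (p : ℕ) [Fact p.Prime] : (cubicPolyMod p).Monic := cubicPoly_monic.map _

/-- `f mod p` has degree `3`. [folklore] -/
theorem natDegree_cubicPolyMod (p : ℕ) [Fact p.Prime] : (cubicPolyMod p).natDegree = 3 := by
  rw [cubicPolyMod, cubicPoly_monic.natDegree_map, cubicPoly_natDegree]

/-- Evaluation of `f mod p`. [folklore] -/
theorem eval_cubicPolyMod (p : ℕ) (c : ZMod p) : (cubicPolyMod p).eval c = c ^ 3 + c ^ 2 - 446 * c - 3769 := by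
  simp [cubicPolyMod, cubicPoly]

/-- `f mod p` written out. [folklore] -/
theorem cubicPolyMod_eq (p : ℕ) : cubicPolyMod p = X ^ 3 + X ^ 2 - C (446 : ZMod p) * X - C 3769 := by
  rw [cubicPolyMod, cubicPoly, Polynomial.map_sub, Polynomial.map_sub, Polynomial.map_add,
    Polynomial.map_pow, Polynomial.map_pow, map_X, Polynomial.map_mul, Polynomial.map_C,
    Polynomial.map_C, map_X, show (Int.castRingHom (ZMod p)) 446 = 446 from map_ofNat _ _,
    show (Int.castRingHom (ZMod p)) 3769 = 3769 from map_ofNat _ _]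

/-- `θint` is a root of `f` in `𝓞 K`. [folklore] -/
theorem aeval_θint : aeval θint cubicPoly = 0 := by
  apply IsFractionRing.injective (𝓞 K) K
  rw [map_zero, ← aeval_algebraMap_apply]
  exact aeval_θ_cubicPoly

/-- **Dedekind–Kummer for `𝓞 K = ℤ[θ]`**: a prime `P` above `p` is `(p, Q(θ))` for any integer lift `Q`
of the corresponding monic irreducible factor of `f mod p`, of residue degree its degree. [folklore] -/
theorem exists_factor_of_mem_primesOver {p : ℕ} (hp : p.Prime) {P : Ideal (𝓞 K)}
    (hP : P ∈ primesOver (span {(p : ℤ)}) (𝓞 K)) :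
    ∃ Qb : (ZMod p)[X], Irreducible Qb ∧ Qb.Monic ∧ Qb ∣ cubicPolyMod p ∧
      P.inertiaDeg ℤ = Qb.natDegree ∧
      ∀ Q : ℤ[X], Q.map (Int.castRingHom (ZMod p)) = Qb → P = span {(p : 𝓞 K), aeval θint Q} := by
  haveI := Fact.mk hp
  have hexp : ¬ p ∣ RingOfIntegers.exponent θint := by
    rw [exponent_θint, Nat.dvd_one]
    exact hp.ne_one
  set e := NumberField.Ideal.primesOverSpanEquivMonicFactorsMod (K := K) hexp with he
  set Qb := e ⟨P, hP⟩ with hQb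
  have hmem : (Qb : (ZMod p)[X]) ∈ RingOfIntegers.monicFactorsMod θint p := Qb.2
  have hmem' := hmem
  simp only [RingOfIntegers.monicFactorsMod, Multiset.mem_toFinset, minpoly_θint] at hmem'
  have h0 : cubicPolyMod p ≠ 0 := (monic_cubicPolyMod p).ne_zero
  obtain ⟨hirr, hmon, hdvd⟩ := (Polynomial.mem_normalizedFactors_iff h0).mp hmem'
  refine ⟨Qb, hirr, hmon, hdvd, ?_, ?_⟩
  · have := NumberField.Ideal.inertiaDeg_primesOverSpanEquivMonicFactorsMod_symm_apply' hexp hmem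
    rwa [show (⟨(Qb : (ZMod p)[X]), hmem⟩ : RingOfIntegers.monicFactorsMod θint p) = Qb
      from Subtype.ext rfl, Equiv.symm_apply_apply] at this
  · intro Q hQ
    have hmemQ : Q.map (Int.castRingHom (ZMod p)) ∈ RingOfIntegers.monicFactorsMod θint p := hQ ▸ hmem
    have h1 := NumberField.Ideal.primesOverSpanEquivMonicFactorsMod_symm_apply_eq_span hexp hmemQ
    have h2 : (⟨Q.map (Int.castRingHom (ZMod p)), hmemQ⟩ :
        RingOfIntegers.monicFactorsMod θint p) = Qb := Subtype.ext hQ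
    rw [h2, hQb, Equiv.symm_apply_apply] at h1
    exact h1

/-- **Inert primes**: if `f` has no root modulo `p`, every prime above `p` is `(p)`, of residue degree
`3`. [folklore] -/
theorem eq_span_of_no_root {p : ℕ} (hp : p.Prime) {P : Ideal (𝓞 K)}
    (hP : P ∈ primesOver (span {(p : ℤ)}) (𝓞 K))
    (hnr : ∀ c : ZMod p, c ^ 3 + c ^ 2 - 446 * c - 3769 ≠ 0) :
    P = span {(p : 𝓞 K)} ∧ P.inertiaDeg ℤ = 3 := by
  haveI := Fact.mk hp
  obtain ⟨Qb, hirr, hmon, hdvd, hdeg, hspan⟩ := exists_factor_of_mem_primesOver hp hP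
  have hfirr : Irreducible (cubicPolyMod p) := by
    refine irreducible_of_degree_le_three_of_not_isRoot
      (by rw [natDegree_cubicPolyMod]; decide) fun c hc => hnr c ?_
    rwa [IsRoot.def, eval_cubicPolyMod] at hc
  have hQb : Qb = cubicPolyMod p :=
    eq_of_monic_of_associated hmon (monic_cubicPolyMod p) (hirr.associated_of_dvd hfirr hdvd)
  refine ⟨?_, by rw [hdeg, hQb, natDegree_cubicPolyMod]⟩
  have h := hspan cubicPoly (by rw [hQb]; rfl)
  rw [aeval_θint] at h
  rw [h, Ideal.span_insert, Ideal.span_singleton_eq_bot.mpr rfl, sup_bot_eq]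

/-- `f` has no root modulo `2, 3, 5` (these primes are inert). [folklore] -/
theorem no_root :
    (∀ c : ZMod 2, c ^ 3 + c ^ 2 - 446 * c - 3769 ≠ 0) ∧ (∀ c : ZMod 3, c ^ 3 + c ^ 2 - 446 * c - 3769 ≠ 0) ∧
    (∀ c : ZMod 5, c ^ 3 + c ^ 2 - 446 * c - 3769 ≠ 0) := by
  refine ⟨by decide, by decide, by decide⟩

/-- A prime `P` of `𝓞 K` containing the rational prime `p` lies over `(p) ⊂ ℤ`. [folklore] -/
theorem mem_primesOver_of_mem {p : ℕ} (hp : p.Prime) {P : Ideal (𝓞 K)} [hP : P.IsPrime]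
    (hmem : (p : 𝓞 K) ∈ P) : P ∈ primesOver (span {(p : ℤ)}) (𝓞 K) := by
  haveI : Fact p.Prime := ⟨hp⟩
  refine ⟨hP, ⟨?_⟩⟩
  refine (Int.ideal_span_isMaximal_of_prime p).eq_of_le (Ideal.comap_ne_top _ hP.ne_top) ?_
  rw [Ideal.span_singleton_le_iff_mem, Ideal.mem_comap, map_natCast]
  exact hmem

/-- A prime of `𝓞 K` above the rational prime `p` contains `p`. [folklore] -/
theorem natCast_mem_of_mem_primesOver {p : ℕ} {P : Ideal (𝓞 K)}
    (hP : P ∈ primesOver (span {(p : ℤ)}) (𝓞 K)) : (p : 𝓞 K) ∈ P := by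
  have h : ((p : ℤ) : 𝓞 K) ∈ P := by
    have hu : (p : ℤ) ∈ P.under ℤ := by rw [← hP.2.over]; exact Ideal.mem_span_singleton_self _
    exact hu
  simpa using h

/-- **The inert primes `p = 2, 3, 5`**: `(p)` is prime of residue degree `3` and is the only prime
above `p`. [folklore] -/
theorem span_inert {p : ℕ} (hp : p = 2 ∨ p = 3 ∨ p = 5) :
    (span {(p : 𝓞 K)}).IsPrime ∧ (span {(p : 𝓞 K)}).inertiaDeg ℤ = 3 ∧
      ∀ P ∈ primesOver (span {(p : ℤ)}) (𝓞 K), P = span {(p : 𝓞 K)} := by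
  have hprime : p.Prime := by rcases hp with rfl | rfl | rfl <;> norm_num
  have hnr : ∀ c : ZMod p, c ^ 3 + c ^ 2 - 446 * c - 3769 ≠ 0 := by
    obtain ⟨n2, n3, n5⟩ := no_root
    rcases hp with rfl | rfl | rfl
    exacts [n2, n3, n5]
  have hall : ∀ P ∈ primesOver (span {(p : ℤ)}) (𝓞 K), P = span {(p : 𝓞 K)} ∧ P.inertiaDeg ℤ = 3 :=
    fun P hP => eq_span_of_no_root hprime hP hnr
  haveI : Fact (Nat.Prime p) := ⟨hprime⟩
  haveI : (span {(p : ℤ)}).IsPrime := (Int.ideal_span_isMaximal_of_prime p).isPrime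
  obtain ⟨⟨P, hP⟩⟩ := Ideal.nonempty_primesOver (S := 𝓞 K) (span {(p : ℤ)})
  obtain ⟨hPeq, hdeg⟩ := hall P hP
  subst hPeq
  exact ⟨hP.1, hdeg, fun Q hQ => (hall Q hQ).1⟩

/-! ### `ℤ[X]/(f) ≅ 𝓞 K` and the residue maps `ψ_{p,m}` -/

/-- **`ℤ[X]/(f) ≅ 𝓞 K`**, the root going to `θ`. [folklore] -/
theorem exists_ringEquiv_adjoinRoot :
    ∃ e : AdjoinRoot cubicPoly ≃+* 𝓞 K, e (AdjoinRoot.root cubicPoly) = θint := by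
  have key : ∀ g : ℤ[X], g = minpoly ℤ θint →
      ∃ e : AdjoinRoot g ≃+* 𝓞 K, e (AdjoinRoot.root g) = θint := by
    intro g hg
    subst hg
    have hint : IsIntegral ℤ θint := Algebra.IsIntegral.isIntegral _
    let e₁ := minpoly.equivAdjoin hint
    let e₂ : Algebra.adjoin ℤ ({θint} : Set (𝓞 K)) ≃ₐ[ℤ] 𝓞 K :=
      (Subalgebra.equivOfEq _ _ adjoin_θint_eq_top).trans Subalgebra.topEquiv
    refine ⟨(e₁.trans e₂).toRingEquiv, ?_⟩
    have h1 : ((e₁ (AdjoinRoot.root _) : Algebra.adjoin ℤ ({θint} : Set (𝓞 K))) : 𝓞 K) = θint := by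
      change ((minpoly.equivAdjoin hint (AdjoinRoot.mk _ X) : Algebra.adjoin ℤ _) : 𝓞 K) = _
      rw [minpoly.coe_equivAdjoin]
      exact AdjoinRoot.Minpoly.coe_toAdjoin_mk_X
    have h2 : ∀ y, e₂ y = (y : 𝓞 K) := fun y => rfl
    change e₂ (e₁ (AdjoinRoot.root _)) = θint
    rw [h2, h1]
  exact key cubicPoly minpoly_θint.symm

/-- **Ring homomorphisms out of `𝓞 K = ℤ[θ]`**: for every commutative ring `R` and root `r ∈ R` of
`f` there is `ψ : 𝓞 K →+* R` with `ψ(θ) = r`. [folklore] -/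
theorem exists_ringHom_apply_θint {R : Type*} [CommRing R] (r : R) (hr : r ^ 3 + r ^ 2 - 446 * r - 3769 = 0) :
    ∃ ψ : 𝓞 K →+* R, ψ θint = r := by
  obtain ⟨e, he⟩ := exists_ringEquiv_adjoinRoot
  have hev : cubicPoly.eval₂ (Int.castRingHom R) r = 0 := by
    rw [cubicPoly, eval₂_sub, eval₂_sub, eval₂_add, eval₂_X_pow, eval₂_X_pow, eval₂_mul, eval₂_C,
      eval₂_X, eval₂_C, map_ofNat, map_ofNat]
    exact hr
  refine ⟨(AdjoinRoot.lift (Int.castRingHom R) r hev).comp e.symm.toRingHom, ?_⟩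
  rw [RingHom.comp_apply]
  change AdjoinRoot.lift _ _ hev (e.symm θint) = _
  rw [← he, e.symm_apply_apply, AdjoinRoot.lift_root]

/-- A root `m` of `f` modulo `p`, given as an integer with `f(m) ≡ 0 (mod p)`, is a root of `f` in
`ℤ/p`. [folklore] -/
theorem root_zmod_of_int {p : ℕ} {m : ℤ} (hm : ((m ^ 3 + m ^ 2 - 446 * m - 3769 : ℤ) : ZMod p) = 0) :
    (m : ZMod p) ^ 3 + (m : ZMod p) ^ 2 - 446 * (m : ZMod p) - 3769 = 0 := by
  push_cast at hm; exact hm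

/-- **The residue map `ψ_{p,m} : 𝓞 K → ℤ/p`, `θ ↦ m`**, for a root `m` of `f mod p`. [folklore] -/
def ψ (p : ℕ) (m : ℤ) (hm : ((m ^ 3 + m ^ 2 - 446 * m - 3769 : ℤ) : ZMod p) = 0) : 𝓞 K →+* ZMod p :=
  Classical.choose (exists_ringHom_apply_θint (m : ZMod p) (root_zmod_of_int hm))

/-- `ψ_{p,m}(θ) = m`. [folklore] -/
@[simp] theorem ψ_θint (p : ℕ) (m : ℤ) (hm : ((m ^ 3 + m ^ 2 - 446 * m - 3769 : ℤ) : ZMod p) = 0) :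
    ψ p m hm θint = (m : ZMod p) :=
  Classical.choose_spec (exists_ringHom_apply_θint (m : ZMod p) (root_zmod_of_int hm))

/-- `ψ_{p,m}` is surjective. [folklore] -/
theorem ψ_surjective (p : ℕ) [Fact p.Prime] (m : ℤ) (hm : ((m ^ 3 + m ^ 2 - 446 * m - 3769 : ℤ) : ZMod p) = 0) :
    Function.Surjective (ψ p m hm) := ZMod.ringHom_surjective _

/-- **The prime ideal `𝔭_{p,m} = ker ψ_{p,m}`** (`= (p, θ - m)`). [folklore] -/
def P (p : ℕ) (m : ℤ) (hm : ((m ^ 3 + m ^ 2 - 446 * m - 3769 : ℤ) : ZMod p) = 0) : Ideal (𝓞 K) :=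
  RingHom.ker (ψ p m hm)

section Pfacts

variable {p : ℕ} {m : ℤ} (hm : ((m ^ 3 + m ^ 2 - 446 * m - 3769 : ℤ) : ZMod p) = 0)
include hm

/-- Membership in `𝔭_{p,m}` is the vanishing of `ψ_{p,m}` (decidable on explicit elements). [folklore] -/
theorem mem_P_iff {x : 𝓞 K} : x ∈ P p m hm ↔ ψ p m hm x = 0 := RingHom.mem_ker

/-- `𝔭_{p,m}` is maximal. [folklore] -/
theorem isMaximal_P [Fact p.Prime] : (P p m hm).IsMaximal :=
  RingHom.ker_isMaximal_of_surjective _ (ψ_surjective p m hm)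

/-- **`N(𝔭_{p,m}) = p`** (`𝓞 K/𝔭 ≅ ℤ/p`). [folklore] -/
theorem absNorm_P [Fact p.Prime] : absNorm (P p m hm) = p := by
  have e := RingHom.quotientKerEquivOfSurjective (ψ_surjective p m hm)
  rw [P, Ideal.absNorm_apply, Submodule.cardQuot_apply, Nat.card_congr e.toEquiv, Nat.card_zmod]

/-- `𝔭_{p,m} ≠ 0`. [folklore] -/
theorem P_ne_bot [Fact p.Prime] : P p m hm ≠ ⊥ := by
  intro h
  have := absNorm_P hm
  rw [h, Ideal.absNorm_bot] at this
  exact (Fact.out : p.Prime).ne_zero this.symm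

/-- `p ∈ 𝔭_{p,m}`. [folklore] -/
theorem natCast_mem_P : (p : 𝓞 K) ∈ P p m hm := by
  rw [mem_P_iff, map_natCast, ZMod.natCast_self]

/-- `θ - m ∈ 𝔭_{p,m}`. [folklore] -/
theorem θint_sub_mem_P : (θint - m : 𝓞 K) ∈ P p m hm := by
  rw [mem_P_iff, map_sub, ψ_θint, map_intCast, sub_self]

/-- `𝔭_{p,m}` lies over `p`. [folklore] -/
theorem P_mem_primesOver [Fact p.Prime] : P p m hm ∈ primesOver (span {(p : ℤ)}) (𝓞 K) := by
  haveI := (isMaximal_P hm).isPrime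
  exact mem_primesOver_of_mem (Fact.out) (natCast_mem_P hm)

end Pfacts

/-- **Distinct roots give distinct primes**: `𝔭_{p,m} ≠ 𝔭_{p,m'}` if `m ≢ m' (mod p)`. [folklore] -/
theorem P_ne_P {p : ℕ} {m m' : ℤ} (hm : ((m ^ 3 + m ^ 2 - 446 * m - 3769 : ℤ) : ZMod p) = 0)
    (hm' : ((m' ^ 3 + m' ^ 2 - 446 * m' - 3769 : ℤ) : ZMod p) = 0) (hne : ((m' - m : ℤ) : ZMod p) ≠ 0) :
    P p m hm ≠ P p m' hm' := by
  intro h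
  have hmem : (θint - m' : 𝓞 K) ∈ P p m hm := by rw [h]; exact θint_sub_mem_P hm'
  rw [mem_P_iff, map_sub, ψ_θint, map_intCast] at hmem
  apply hne
  push_cast
  linear_combination -hmem

/-- **Primes above different rational primes are distinct.** [folklore] -/
theorem P_ne_P' {p q : ℕ} {m m' : ℤ}
    (hm : ((m ^ 3 + m ^ 2 - 446 * m - 3769 : ℤ) : ZMod p) = 0)
    (hm' : ((m' ^ 3 + m' ^ 2 - 446 * m' - 3769 : ℤ) : ZMod q) = 0) (hpq : ((p : ℕ) : ZMod q) ≠ 0) :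
    P p m hm ≠ P q m' hm' := by
  intro h
  have hmem : (p : 𝓞 K) ∈ P q m' hm' := by rw [← h]; exact natCast_mem_P hm
  rw [mem_P_iff, map_natCast] at hmem
  exact hpq hmem

/-! ### Norms of explicit elements and certified factorisations -/

/-- **The integer norm form** of `a + bθ + cθ²` (the cubic form `norm_quadratic c b a`). [folklore] -/
def normForm (a b c : ℤ) : ℤ :=
  a * ((446 * c + a) * (447 * c - b + a) - (3323 * c + 446 * b) * (b - c))
    - 3769 * c * (b * (447 * c - b + a) - (3323 * c + 446 * b) * c)
    + (-3769 * c + 3769 * b) * (b * (b - c) - (446 * c + a) * c)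

/-- `N(a + bθ + cθ²) = normForm a b c`. [folklore] -/
theorem norm_lin (a b c : ℤ) :
    Algebra.norm ℤ (((a : 𝓞 K) + (b : 𝓞 K) * θint + (c : 𝓞 K) * θint ^ 2 : 𝓞 K)) = normForm a b c := by
  have h := Algebra.coe_norm_int (((a : 𝓞 K) + (b : 𝓞 K) * θint + (c : 𝓞 K) * θint ^ 2 : 𝓞 K))
  have hK : (((a : 𝓞 K) + (b : 𝓞 K) * θint + (c : 𝓞 K) * θint ^ 2 : 𝓞 K) : K) =
      ((c : ℚ) : K) * θ ^ 2 + ((b : ℚ) : K) * θ + ((a : ℚ) : K) := by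
    simp only [map_add, map_mul, map_pow, map_intCast, coe_θint]; push_cast; ring
  rw [hK, norm_quadratic] at h
  have h' : ((Algebra.norm ℤ (((a : 𝓞 K) + (b : 𝓞 K) * θint + (c : 𝓞 K) * θint ^ 2 : 𝓞 K)) : ℤ) : ℚ) =
      ((normForm a b c : ℤ) : ℚ) := by
    rw [h, normForm]; push_cast; ring
  exact_mod_cast h'

/-- **`N((a + bθ + cθ²)) = |normForm a b c|`.** [folklore] -/
theorem absNorm_span_lin (a b c : ℤ) :
    absNorm (span {((a : 𝓞 K) + (b : 𝓞 K) * θint + (c : 𝓞 K) * θint ^ 2 : 𝓞 K)}) = (normForm a b c).natAbs := by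
  rw [absNorm_span_singleton, norm_lin]

/-- Two ideals `I ≤ J` of equal non-zero norm are equal (`J ∣ I`, and the cofactor has norm `1`).
[folklore] -/
theorem eq_of_le_of_absNorm_eq {I J : Ideal (𝓞 K)} (hle : I ≤ J) (hN : absNorm I = absNorm J)
    (h0 : absNorm I ≠ 0) : I = J := by
  obtain ⟨L, hL⟩ := Ideal.dvd_iff_le.mpr hle
  have hmul : absNorm I = absNorm J * absNorm L := by rw [hL, map_mul]
  rw [hN] at hmul h0
  have hJ0 : absNorm J ≠ 0 := fun h => h0 (by rw [h])
  have hL1 : absNorm L = 1 := mul_left_cancel₀ hJ0 (hmul.symm.trans (mul_one _).symm)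
  rw [Ideal.absNorm_eq_one_iff] at hL1
  rw [hL, hL1, Ideal.mul_top]

/-- **Certified factorisation into three distinct primes**: if `x ∈ 𝔭₁, 𝔭₂, 𝔭₃` (pairwise distinct
maximal ideals) and `N((x)) = N(𝔭₁)N(𝔭₂)N(𝔭₃) ≠ 0`, then `(x) = 𝔭₁𝔭₂𝔭₃`. [folklore] -/
theorem span_singleton_eq_mul₃ {x : 𝓞 K} {P₁ P₂ P₃ : Ideal (𝓞 K)} (h₁ : P₁.IsMaximal) (h₂ : P₂.IsMaximal)
    (h₃ : P₃.IsMaximal) (h₁₂ : P₁ ≠ P₂) (h₁₃ : P₁ ≠ P₃) (h₂₃ : P₂ ≠ P₃)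
    (hx₁ : x ∈ P₁) (hx₂ : x ∈ P₂) (hx₃ : x ∈ P₃)
    (hN : absNorm (span {x}) = absNorm P₁ * absNorm P₂ * absNorm P₃) (hN0 : absNorm (span {x}) ≠ 0) :
    span {x} = P₁ * P₂ * P₃ := by
  have c₁₂ : IsCoprime P₁ P₂ := (Ideal.isCoprime_iff_sup_eq.mpr (h₁.coprime_of_ne h₂ h₁₂))
  have c₁₃ : IsCoprime P₁ P₃ := (Ideal.isCoprime_iff_sup_eq.mpr (h₁.coprime_of_ne h₃ h₁₃))
  have c₂₃ : IsCoprime P₂ P₃ := (Ideal.isCoprime_iff_sup_eq.mpr (h₂.coprime_of_ne h₃ h₂₃))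
  have hinf : P₁ * P₂ * P₃ = P₁ ⊓ P₂ ⊓ P₃ := by
    rw [Ideal.mul_eq_inf_of_isCoprime (c₁₃.mul_left c₂₃), Ideal.mul_eq_inf_of_isCoprime c₁₂]
  have hle : span {x} ≤ P₁ * P₂ * P₃ := by
    rw [hinf, span_singleton_le_iff_mem]
    exact ⟨⟨hx₁, hx₂⟩, hx₃⟩
  refine eq_of_le_of_absNorm_eq hle ?_ hN0
  rw [hN, map_mul, map_mul]

/-- Certified factorisation into two distinct primes. [folklore] -/
theorem span_singleton_eq_mul₂ {x : 𝓞 K} {P₁ P₂ : Ideal (𝓞 K)} (h₁ : P₁.IsMaximal) (h₂ : P₂.IsMaximal)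
    (h₁₂ : P₁ ≠ P₂) (hx₁ : x ∈ P₁) (hx₂ : x ∈ P₂)
    (hN : absNorm (span {x}) = absNorm P₁ * absNorm P₂) (hN0 : absNorm (span {x}) ≠ 0) :
    span {x} = P₁ * P₂ := by
  have c₁₂ : IsCoprime P₁ P₂ := (Ideal.isCoprime_iff_sup_eq.mpr (h₁.coprime_of_ne h₂ h₁₂))
  have hle : span {x} ≤ P₁ * P₂ := by
    rw [Ideal.mul_eq_inf_of_isCoprime c₁₂, span_singleton_le_iff_mem]
    exact ⟨hx₁, hx₂⟩
  refine eq_of_le_of_absNorm_eq hle ?_ hN0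
  rw [hN, map_mul]

/-- Certified principal prime: `x ∈ 𝔭` with `N((x)) = N(𝔭) ≠ 0` gives `(x) = 𝔭`. [folklore] -/
theorem span_singleton_eq_of_mem {x : 𝓞 K} {P₁ : Ideal (𝓞 K)} (hx₁ : x ∈ P₁)
    (hN : absNorm (span {x}) = absNorm P₁) (hN0 : absNorm (span {x}) ≠ 0) : span {x} = P₁ :=
  eq_of_le_of_absNorm_eq ((span_singleton_le_iff_mem _).mpr hx₁) hN hN0

/-! ### Split primes: every prime above `p` is one of the `𝔭_{p,mᵢ}` -/

/-- `(X - m₁)(X - m₂)(X - m₃)` expanded. [folklore] -/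
theorem prod_X_sub_C {R : Type*} [CommRing R] (m₁ m₂ m₃ : R) :
    (X - C m₁) * (X - C m₂) * (X - C m₃) =
      X ^ 3 - C (m₁ + m₂ + m₃) * X ^ 2 + C (m₁ * m₂ + m₁ * m₃ + m₂ * m₃) * X - C (m₁ * m₂ * m₃) := by
  simp only [map_add, map_mul]
  ring

/-- **`f ≡ (X - m₁)(X - m₂)(X - m₃) (mod p)` from the Vieta congruences**
`m₁ + m₂ + m₃ ≡ -1`, `m₁m₂ + m₁m₃ + m₂m₃ ≡ -446`, `m₁m₂m₃ ≡ 3769`. [folklore] -/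
theorem cubicPolyMod_eq_prod {p : ℕ} {m₁ m₂ m₃ : ℤ}
    (h1 : ((m₁ + m₂ + m₃ : ℤ) : ZMod p) = -1) (h2 : ((m₁ * m₂ + m₁ * m₃ + m₂ * m₃ : ℤ) : ZMod p) = -446)
    (h3 : ((m₁ * m₂ * m₃ : ℤ) : ZMod p) = 3769) :
    cubicPolyMod p = (X - C (m₁ : ZMod p)) * (X - C (m₂ : ZMod p)) * (X - C (m₃ : ZMod p)) := by
  push_cast at h1 h2 h3
  rw [prod_X_sub_C, h1, h2, h3, cubicPolyMod_eq, map_neg, map_neg, map_one]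
  ring

/-- A root of the factorisation is a root. [folklore] -/
theorem root_of_vieta {p : ℕ} {m₁ m₂ m₃ : ℤ}
    (h1 : ((m₁ + m₂ + m₃ : ℤ) : ZMod p) = -1) (h2 : ((m₁ * m₂ + m₁ * m₃ + m₂ * m₃ : ℤ) : ZMod p) = -446)
    (h3 : ((m₁ * m₂ * m₃ : ℤ) : ZMod p) = 3769) :
    ((m₁ ^ 3 + m₁ ^ 2 - 446 * m₁ - 3769 : ℤ) : ZMod p) = 0 ∧
    ((m₂ ^ 3 + m₂ ^ 2 - 446 * m₂ - 3769 : ℤ) : ZMod p) = 0 ∧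
    ((m₃ ^ 3 + m₃ ^ 2 - 446 * m₃ - 3769 : ℤ) : ZMod p) = 0 := by
  have key : ∀ m : ℤ, (cubicPolyMod p).eval (m : ZMod p) = 0 →
      ((m ^ 3 + m ^ 2 - 446 * m - 3769 : ℤ) : ZMod p) = 0 := by
    intro m hm; rw [eval_cubicPolyMod] at hm; push_cast; exact hm
  have hf := cubicPolyMod_eq_prod h1 h2 h3
  refine ⟨key m₁ ?_, key m₂ ?_, key m₃ ?_⟩
  · rw [hf, eval_mul, eval_mul]; simp
  · rw [hf, eval_mul, eval_mul]; simp
  · rw [hf, eval_mul]; simp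

/-- **Every prime of `𝓞 K` above a prime `p` with `f ≡ (X - m₁)(X - m₂)(X - m₃) (mod p)` is one of
`𝔭_{p,m₁}, 𝔭_{p,m₂}, 𝔭_{p,m₃}`** (Dedekind–Kummer: its factor of `f mod p` is one of the linear factors,
so it is `(p, θ - mᵢ) ⊆ 𝔭_{p,mᵢ}`, and it is maximal). For `13`, `103` (`f ≡ (X - m)³`) the three
coincide. [folklore] -/
theorem eq_P_of_mem_primesOver {p : ℕ} (hp : p.Prime) {m₁ m₂ m₃ : ℤ}
    (h1 : ((m₁ + m₂ + m₃ : ℤ) : ZMod p) = -1) (h2 : ((m₁ * m₂ + m₁ * m₃ + m₂ * m₃ : ℤ) : ZMod p) = -446)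
    (h3 : ((m₁ * m₂ * m₃ : ℤ) : ZMod p) = 3769) {Q : Ideal (𝓞 K)}
    (hQ : Q ∈ primesOver (span {(p : ℤ)}) (𝓞 K)) :
    Q = P p m₁ (root_of_vieta h1 h2 h3).1 ∨ Q = P p m₂ (root_of_vieta h1 h2 h3).2.1 ∨
      Q = P p m₃ (root_of_vieta h1 h2 h3).2.2 := by
  haveI : Fact (Nat.Prime p) := ⟨hp⟩
  obtain ⟨Qb, hirr, hmon, hdvd, -, hspan⟩ := exists_factor_of_mem_primesOver hp hQ
  rw [cubicPolyMod_eq_prod h1 h2 h3] at hdvd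
  have key : ∀ c : ZMod p, Qb ∣ X - C c → Qb = X - C c := fun c hc =>
    eq_of_monic_of_associated hmon (monic_X_sub_C c) (hirr.associated_of_dvd (irreducible_X_sub_C c) hc)
  haveI := hQ.1
  have hQmax : Q.IsMaximal := by
    refine hQ.1.isMaximal fun h => ?_
    have hmem := natCast_mem_of_mem_primesOver hQ
    rw [h, Ideal.mem_bot] at hmem
    exact hp.ne_zero (by exact_mod_cast hmem)
  have conclude : ∀ (m : ℤ) (hm : ((m ^ 3 + m ^ 2 - 446 * m - 3769 : ℤ) : ZMod p) = 0),
      Qb = X - C (m : ZMod p) → Q = P p m hm := by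
    intro m hm hQb
    have h := hspan (X - C m) (by rw [Polynomial.map_sub, map_X, Polynomial.map_C, eq_intCast, hQb])
    rw [map_sub, aeval_X, aeval_C, algebraMap_int_eq, eq_intCast] at h
    have hle : Q ≤ P p m hm := by
      rw [h, Ideal.span_le, Set.insert_subset_iff, Set.singleton_subset_iff]
      exact ⟨natCast_mem_P hm, θint_sub_mem_P hm⟩
    exact hQmax.eq_of_le (isMaximal_P hm).ne_top hle
  rcases hirr.prime.dvd_or_dvd hdvd with h12 | h3'
  · rcases hirr.prime.dvd_or_dvd h12 with h1' | h2'
    · exact Or.inl (conclude m₁ _ (key _ h1'))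
    · exact Or.inr (Or.inl (conclude m₂ _ (key _ h2')))
  · exact Or.inr (Or.inr (conclude m₃ _ (key _ h3')))

/-! ### The discriminant `d_K = 1339²` and the Minkowski bound -/

/-- The integral basis `1, θ, θ²` as a family. [folklore] -/
def intFamily : Fin 3 → 𝓞 K := ![1, θint, θint ^ 2]

/-- `1, θ, θ²` are linearly independent over `ℤ`. [folklore] -/
theorem linearIndependent_intFamily : LinearIndependent ℤ intFamily := by
  rw [Fintype.linearIndependent_iff]
  intro g hg i
  rw [Fin.sum_univ_three] at hg
  simp only [intFamily, Matrix.cons_val_zero, Matrix.cons_val_one, Matrix.cons_val_two,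
    Matrix.tail_cons, Matrix.head_cons, zsmul_eq_mul] at hg
  have h2 := congrArg (fun x : 𝓞 K => (x : K)) hg
  simp only [map_add, map_mul, map_pow, map_intCast, map_zero, coe_θint, mul_one] at h2
  have hq : (((g 2 : ℤ) : ℚ) : K) * θ ^ 2 + (((g 1 : ℤ) : ℚ) : K) * θ + (((g 0 : ℤ) : ℚ) : K) = 0 := by
    push_cast; linear_combination h2
  by_contra hne
  refine quadratic_ne_zero ?_ hq
  intro h0
  simp only [Prod.mk.injEq, Int.cast_eq_zero] at h0
  obtain ⟨h2', h1', h0'⟩ := h0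
  fin_cases i
  · exact hne h0'
  · exact hne h1'
  · exact hne h2'

/-- `1, θ, θ²` span `𝓞 K` over `ℤ`. [folklore] -/
theorem span_intFamily : ⊤ ≤ Submodule.span ℤ (Set.range intFamily) := by
  intro z _
  obtain ⟨a, b, c, rfl⟩ := exists_int_coords z
  have h0 : (1 : 𝓞 K) ∈ Submodule.span ℤ (Set.range intFamily) := Submodule.subset_span ⟨0, rfl⟩
  have h1 : (θint : 𝓞 K) ∈ Submodule.span ℤ (Set.range intFamily) := Submodule.subset_span ⟨1, rfl⟩
  have h2 : (θint ^ 2 : 𝓞 K) ∈ Submodule.span ℤ (Set.range intFamily) := Submodule.subset_span ⟨2, rfl⟩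
  have e : (a : 𝓞 K) * θint ^ 2 + b * θint + c = a • (θint ^ 2 : 𝓞 K) + b • θint + c • (1 : 𝓞 K) := by
    simp only [zsmul_eq_mul, mul_one]
  rw [e]
  exact Submodule.add_mem _ (Submodule.add_mem _ (Submodule.smul_mem _ _ h2)
    (Submodule.smul_mem _ _ h1)) (Submodule.smul_mem _ _ h0)

/-- **The integral basis `1, θ, θ²` of `𝓞 K`** as a `ℤ`-basis. [folklore] -/
def intBasis : Module.Basis (Fin 3) ℤ (𝓞 K) := Module.Basis.mk linearIndependent_intFamily span_intFamily

/-- The elements of `intBasis` in `K` are the powers of `θ`. [folklore] -/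
theorem intBasis_apply_coe (i : Fin 3) : ((intBasis i : 𝓞 K) : K) = pbθ.basis ((finCongr pbθ_dim).symm i) := by
  rw [intBasis, Module.Basis.mk_apply, PowerBasis.coe_basis, pbθ_gen]
  fin_cases i <;> simp [intFamily]

/-- **`d_K = 1792921 = 1339²`.** [folklore] -/
theorem discr_eq : NumberField.discr K = 1792921 := by
  classical
  apply (algebraMap ℤ ℚ).injective_int
  rw [← NumberField.discr_eq_discr _ intBasis, ← Algebra.discr_localizationLocalization ℤ
    (nonZeroDivisors ℤ) K]
  have hfam : ⇑(intBasis.localizationLocalization ℚ (nonZeroDivisors ℤ) K) =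
      fun i : Fin 3 => pbθ.basis ((finCongr pbθ_dim).symm i) := by
    ext i
    rw [Module.Basis.localizationLocalization_apply, ← intBasis_apply_coe]
  have hre : Algebra.discr ℚ (fun i : Fin 3 => pbθ.basis ((finCongr pbθ_dim).symm i)) =
      Algebra.discr ℚ pbθ.basis := by
    rw [← Algebra.discr_reindex ℚ pbθ.basis (finCongr pbθ_dim)]
    rfl
  rw [hfam, hre, discr_pbθ]
  norm_num

/-- `r₂ = 0`: `K` has three real embeddings. [folklore] -/
theorem nrComplexPlaces_eq_zero : InfinitePlace.nrComplexPlaces K = 0 := by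
  have h1 := InfinitePlace.card_add_two_mul_card_eq_rank K
  rw [finrank_K] at h1
  have hr : 3 ≤ InfinitePlace.nrRealPlaces K := by
    classical
    rw [← NumberField.InfinitePlace.card_real_embeddings]
    have hreal : ∀ e : K →+* ℝ, ComplexEmbedding.IsReal ((algebraMap ℝ ℂ).comp e) := fun e => by
      rw [ComplexEmbedding.isReal_iff]
      refine RingHom.ext fun x => ?_
      simp only [ComplexEmbedding.conjugate_coe_eq, RingHom.coe_comp, Function.comp_apply,
        Complex.coe_algebraMap, Complex.conj_ofReal]
    let emb : Fin 3 → {φ : K →+* ℂ // ComplexEmbedding.IsReal φ} :=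
      ![⟨_, hreal e₁⟩, ⟨_, hreal e₂⟩, ⟨_, hreal e₃⟩]
    have hval : ∀ i, (emb i).1 θ = ((![r₁, r₂, r₃] i : ℝ) : ℂ) := by
      intro i; fin_cases i <;> simp [emb]
    have hinj : Function.Injective emb := by
      intro i j hij
      have h := congrArg (fun φ : {φ : K →+* ℂ // ComplexEmbedding.IsReal φ} => φ.1 θ) hij
      simp only [hval, Complex.ofReal_inj] at h
      have h1 := r₁_spec.1; have h2 := r₂_spec.1; have h3 := r₃_spec.1
      simp only [Set.mem_Ioo] at h1 h2 h3
      fin_cases i <;> fin_cases j <;> simp at h ⊢ <;> linarith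
    simpa using Fintype.card_le_of_injective emb hinj
  omega

/-- **`⌊M_K⌋ ≤ 297`**: `M_K = (3!/3³) √1792921 = (6/27)·1339 < 298`. [folklore] -/
theorem floor_minkowskiBound_le :
    ⌊(4 / Real.pi) ^ InfinitePlace.nrComplexPlaces K *
        ((Module.finrank ℚ K).factorial / (Module.finrank ℚ K : ℝ) ^ Module.finrank ℚ K *
          Real.sqrt |(NumberField.discr K : ℝ)|)⌋₊ ≤ 297 := by
  have hsqrt : Real.sqrt |(NumberField.discr K : ℝ)| = 1339 := by
    rw [discr_eq, show ((1792921 : ℤ) : ℝ) = (1339 : ℝ) ^ 2 by norm_num, abs_of_nonneg (by positivity),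
      Real.sqrt_sq (by norm_num)]
  rw [finrank_K, hsqrt, nrComplexPlaces_eq_zero, pow_zero, one_mul]
  have hfac : ((3 : ℕ).factorial : ℝ) = 6 := by norm_num [Nat.factorial]
  rw [hfac]
  refine Nat.le_of_lt_succ ((Nat.floor_lt (by positivity)).mpr ?_)
  norm_num

/-- **Minkowski**: every ideal class of `K` contains an integral ideal of norm `≤ 297`. [folklore] -/
theorem exists_ideal_in_class_of_norm_le (c : ClassGroup (𝓞 K)) :
    ∃ I : (Ideal (𝓞 K))⁰, ClassGroup.mk0 I = c ∧ absNorm (I : Ideal (𝓞 K)) ≤ 297 := by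
  obtain ⟨I, hI, hle⟩ := NumberField.exists_ideal_in_class_of_norm_le c
  refine ⟨I, hI, ?_⟩
  have h := Nat.le_floor (α := ℝ) (n := absNorm (I : Ideal (𝓞 K))) hle
  exact h.trans floor_minkowskiBound_le

end CyclicCubic1339B

end Literature.NumberTheory.NumberFields

end
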